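/-
search for candidate a priori estimates; no regularity claim

# K82 — (R28) THE BIAXIAL AXIS PROJECTOR: director-free form of an everywhere-biaxial strain,
# the isotropic-mean and line laws, and the hand-off to THEOREM R

Node of record (verbatim, unchanged): L-λ(q) =
`Summit.NavierStokesRegularity.FunctionalMining.TopEigHeatCoercivePos q := ∃ c > 0,`
`TopEigHeatCoercive q c` — OPEN for every real `q > 1`; (F2) killing family WANTED/OPEN. This
file proves NECESSARY CONDITIONS on a smooth divergence-free field on `T³` whose strain has
the portrait `(m, m, −2m)`, `m ≠ 0`, at EVERY point — by K81 (`TopEig.NoCell.exact_witness_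
biaxial`) every exact (F2) witness at real `q > 1` (`heatDissipation Φ_q v ≤ 0`, `Φ_q v > 0`)
is such a field, with `m > 0`; it constructs none, excludes none and decides no node.
THE OBJECT. With (BI) `S² + mS = 2m²·1` (K79 (R25)) at every point, the AXIS PROJECTOR
`P := (3m)⁻¹(m·1 − S)` (`axisProj`) is a smooth field of symmetric idempotents of trace one,
`S = m(1 − 3P)`, and at every point `P = u ⊗ u` for a unit bottom eigenvector, `S u = −2m u`
(`exists_axis`; § 2: `(m·1 − S)² = 3m(m·1 − S)`, and a symmetric idempotent of trace one with
a unit fixed vector `u` IS `u ⊗ u`, since `R := P − u ⊗ u` is a symmetric idempotent with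
`Σ Rᵢⱼ² = tr(RᵀR) = tr R = 0`). So the field is an exact periodic biaxial symmetric gradient
`m(1 − 3 n ⊗ n)` with a smooth LINE-field director `±n` — VERBATIM the hypothesis of the no-go
seat's paper-level THEOREM R (SIEVELD §3.4b (4e); Lipschitz form (4f) R′): no such periodic
field exists. THEOREM R is NOT in the kernel (its steps (i)–(ii) are, for an ORIENTED smooth
axis: `BiaxialTwistFree`), and this file does not prove it.
LAWS, for EVERY smooth field and `m ≠ 0` (§ 1, § 3): (R28a) ISOTROPIC MEAN `∫_{T^d} P = ⅓·1`
(`integral_axisProj_apply`, from `∫ S = 0`), `∫ KᵀP K = |K|²/3` (`integral_axisQuad`); (R28b)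
LINE LAW: along every straight line `t ↦ x + tK` (closed or not) the longitudinal strain
`KᵀS(x + tK)K = (d/dt) K·v(x + tK)` stays neither `≥ c` nor `≤ −c` (`c > 0`), `v` being
bounded — through `P`: `KᵀP K` takes values `> (1/3 − ε)|K|²` AND `< (1/3 + ε)|K|²` on every
line (`exists_axisQuad_gt_and_lt`); (R28c) NO KERNEL RULING: no line along which `P K ≡ 0`,
i.e. `S K ≡ m K` (`no_kernel_ruling`). READING for a biaxial field (§ 4): `KᵀP K/|K|² = cos²`
of the angle (axis, `K`), so (R28a) is its space average `1/3` in EVERY direction, (R28b) the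
LINE MAGIC-ANGLE LAW (inf and sup straddle `1/3` on every line), and (R28c) = NO RULING
ORTHOGONAL TO THE AXIS = step (v) of THEOREM R in the kernel (step (iv) of the paper proof
produces such a ruling inside a flat leaf of `n^⊥`; a ruling need not be rational, whence the
every-line form — the tree has the all-points form by Fermat, `BiaxialEikonal.not_forall_
longitudinalStrain_pos`, and a zero on closed lattice lines, `exists_longitudinalStrain_eq_
zero`). (R28d) ORIENTED HAND-OFF (§ 5): if `P = n ⊗ n` for a smooth vector field `n`, then
`|n| = 1`, `S = m(1 − 3 n ⊗ n)`, and the tree's THEOREM R (i)–(ii) apply BY NAME: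
`n·curl n ≡ 0`, `(div n)² ≡ tr((∇n)²)`.
HONEST PLACEMENT: linear algebra of one polynomial identity, `∫∂ = 0`, boundedness of a periodic
field along a line; the point is the director-free typing by which the kernel chain K57b → K70
→ K78 → K81 ends exactly at THEOREM R's hypothesis, plus (R28c). NOT formalised: orientation of
the axis; THEOREM R (iii)–(iv). No number of record moves. [ours; § 1–§ 2 folklore]
FILING (prove seat g33, REQUEST #113): declarations byte-identical to the no-go seat's staged `TopEigHeatBiaxialAxis.STAGING.lean` 1aac918ea13b795c; this line is the only addition.
-/
import Summits.NavierStokesRegularity.FunctionalMining.NoGo.TopEigHeatCrossingInterior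
import Summits.NavierStokesRegularity.FunctionalMining.BiaxialXRay
import Summits.NavierStokesRegularity.FunctionalMining.BiaxialTwistFree
import HarnessLib

noncomputable section

open Filter Topology Set Matrix MeasureTheory

namespace Summit.NavierStokesRegularity.FunctionalMining

open Literature.Analysis Literature.Analysis.FunctionSpaces Literature.Analysis.FunctionSpaces.Torus
  Literature.Analysis.FluidPDE

namespace TopEig.BiAxis

/-! ## 1. The longitudinal strain keeps no sign bounded away from zero along a line -/

/-- A real function with `|φ| ≤ B` and derivative `≥ c > 0` everywhere does not exist. [folklore] -/
theorem false_of_abs_le_of_hasDerivAt_ge {φ L : ℝ → ℝ} {B c : ℝ} (hc : 0 < c)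
    (hφ : ∀ t, HasDerivAt φ (L t) t) (hB : ∀ t, |φ t| ≤ B) (hL : ∀ t, c ≤ L t) : False := by
  have hd : ∀ t, HasDerivAt (fun s => φ s - c * s) (L t - c * 1) t :=
    fun t => (hφ t).sub ((hasDerivAt_id' t).const_mul c)
  have hmono : Monotone fun s => φ s - c * s :=
    monotone_of_deriv_nonneg (fun t => (hd t).differentiableAt) fun t => by
      rw [(hd t).deriv]; linarith [hL t]
  have hT0 : (0 : ℝ) ≤ (2 * B + 1) / c :=
    div_nonneg (by linarith [(abs_nonneg _).trans (hB 0)]) hc.le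
  have h := hmono hT0
  simp only [mul_zero, sub_zero, mul_div_cancel₀ _ hc.ne'] at h
  linarith [(abs_le.mp (hB 0)).1, (abs_le.mp (hB ((2 * B + 1) / c))).2]

variable {d : Type*} [Fintype d]

/-- The components of a smooth field on the compact torus are uniformly bounded. [folklore] -/
theorem exists_bound_apply {v : UnitAddTorus d → EuclideanSpace ℝ d} (hv : Torus.IsSmooth v) :
    ∃ M : ℝ, ∀ x i, |v x i| ≤ M := by
  obtain ⟨M, hM⟩ := isCompact_univ.exists_bound_of_continuousOn hv.continuous.continuousOn
  exact ⟨M, fun x i => ((Real.norm_eq_abs _).symm.trans_le (PiLp.norm_apply_le (v x) i)).trans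
    (hM x (mem_univ x))⟩

/-- `K ≠ 0` has `Σ Kᵢ² > 0`. [folklore, bookkeeping] -/
theorem sum_sq_pos {K : EuclideanSpace ℝ d} (hK : K ≠ 0) : 0 < ∑ i, K i ^ 2 := by
  obtain ⟨i, hi⟩ : ∃ i, K i ≠ 0 := by
    by_contra h0; push Not at h0; exact hK (PiLp.ext fun i => by rw [h0 i]; rfl)
  exact lt_of_lt_of_le (by positivity) (Finset.single_le_sum (fun k _ => sq_nonneg (K k))
    (Finset.mem_univ i))

variable [DecidableEq d]

/-- **LINE LAW (every smooth field, every dimension, every direction `K`, closed line or not):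
along `t ↦ x + tK` the longitudinal strain `Kᵀ S(v)(x + tK) K` takes values `< c` and values
`> −c`, for every `c > 0`** — `K·v(x + tK)` is bounded with derivative `KᵀSK`. [ours] -/
theorem exists_longitudinalStrain_lt_and_gt {v : UnitAddTorus d → EuclideanSpace ℝ d}
    (hv : Torus.IsSmooth v) (x : UnitAddTorus d) (K : EuclideanSpace ℝ d) {c : ℝ} (hc : 0 < c) :
    (∃ t : ℝ, ∑ i, ∑ j, K i * K j * torusStrainMatrix v (x + Torus.proj (t • K)) i j < c) ∧
      ∃ t : ℝ, -c < ∑ i, ∑ j, K i * K j * torusStrainMatrix v (x + Torus.proj (t • K)) i j := by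
  obtain ⟨M, hM⟩ := exists_bound_apply hv
  have hφ : ∀ t : ℝ, HasDerivAt (fun s : ℝ => ∑ i, K i * v (x + Torus.proj (s • K)) i)
      (∑ i, ∑ j, K i * K j * torusStrainMatrix v (x + Torus.proj (t • K)) i j) t := fun t => by
    rw [← BiaxialEikonal.sum_partialDeriv_eq_sum_strain]
    exact BiaxialEikonal.hasDerivAt_longitudinal hv x K t
  have hB : ∀ t : ℝ, |∑ i, K i * v (x + Torus.proj (t • K)) i| ≤ ∑ i, |K i| * M := fun t =>
    (Finset.abs_sum_le_sum_abs _ _).trans (Finset.sum_le_sum fun i _ => by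
      rw [abs_mul]; exact mul_le_mul_of_nonneg_left (hM _ i) (abs_nonneg _))
  constructor
  · by_contra h
    push Not at h
    exact false_of_abs_le_of_hasDerivAt_ge hc hφ hB h
  · by_contra h
    push Not at h
    exact false_of_abs_le_of_hasDerivAt_ge hc (fun t => (hφ t).neg)
      (fun t => (abs_neg _).trans_le (hB t)) fun t => by linarith [h t]

/-! ## 2. Matrix algebra: the projector of the biaxial polynomial identity -/

section Algebra

variable {n : Type*} [Fintype n]

/-- An idempotent of non-zero trace has a UNIT FIXED VECTOR (a normalised column). [folklore] -/
theorem exists_unit_fixed {P : Matrix n n ℝ} (hP : P * P = P) (htr : Matrix.trace P ≠ 0) :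
    ∃ u : n → ℝ, ∑ i, u i ^ 2 = 1 ∧ P *ᵥ u = u := by
  obtain ⟨i, j, hij⟩ : ∃ i j, P i j ≠ 0 := by
    by_contra h0
    push Not at h0
    exact htr (Finset.sum_eq_zero fun k _ => h0 k k)
  have hPw : P *ᵥ (fun k => P k j) = fun k => P k j := by
    ext k
    have hk := congrFun (congrFun hP k) j
    rw [Matrix.mul_apply] at hk
    simpa only [Matrix.mulVec, dotProduct] using hk
  have hpos : 0 < ∑ k, P k j ^ 2 := lt_of_lt_of_le (by positivity : 0 < P i j ^ 2)
    (Finset.single_le_sum (fun k _ => sq_nonneg (P k j)) (Finset.mem_univ i))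
  refine ⟨(Real.sqrt (∑ k, P k j ^ 2))⁻¹ • fun k => P k j, ?_, by rw [Matrix.mulVec_smul, hPw]⟩
  simp only [Pi.smul_apply, smul_eq_mul, mul_pow, ← Finset.mul_sum, inv_pow, Real.sq_sqrt hpos.le]
  exact inv_mul_cancel₀ hpos.ne'

/-- **RANK ONE: a symmetric idempotent of trace one with a unit fixed vector `u` is `u ⊗ u`**
(`R := P − u ⊗ u` is a symmetric idempotent with `Σ Rᵢⱼ² = tr(RᵀR) = tr R = 0`). [folklore] -/
theorem eq_vecMulVec_of_proj {P : Matrix n n ℝ} (hP : P * P = P) (hPt : Pᵀ = P)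
    (htr : Matrix.trace P = 1) {u : n → ℝ} (hu1 : ∑ i, u i ^ 2 = 1) (hu : P *ᵥ u = u) :
    P = vecMulVec u u := by
  have huu : u ⬝ᵥ u = 1 := by simpa only [dotProduct, sq] using hu1
  have huP : u ᵥ* P = u := by rw [← hPt, Matrix.vecMul_transpose, hu]
  set R : Matrix n n ℝ := P - vecMulVec u u with hR
  have hRt : Rᵀ = R := by rw [hR, transpose_sub, hPt, transpose_vecMulVec]
  have hRR : R * R = R := by
    rw [hR, sub_mul, mul_sub, mul_sub, hP, mul_vecMulVec, hu, vecMulVec_mul, huP,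
      vecMulVec_mul_vecMulVec, huu, one_smul, sub_self, sub_zero]
  have htrace : Matrix.trace (Rᵀ * R) = ∑ i, ∑ j, R i j ^ 2 := by
    simp only [Matrix.trace, Matrix.diag, Matrix.mul_apply, Matrix.transpose_apply, sq]
    exact Finset.sum_comm
  have hsum : ∑ i, ∑ j, R i j ^ 2 = 0 := by
    rw [← htrace, hRt, hRR, hR, Matrix.trace_sub, htr, trace_vecMulVec, huu, sub_self]
  have hzero : ∀ i j, R i j = 0 := fun i j => pow_eq_zero_iff two_ne_zero |>.mp
    ((Finset.sum_eq_zero_iff_of_nonneg fun j _ => sq_nonneg (R i j)).mp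
      ((Finset.sum_eq_zero_iff_of_nonneg fun i _ => Finset.sum_nonneg fun j _ =>
        sq_nonneg (R i j)).mp hsum i (Finset.mem_univ i)) j (Finset.mem_univ j))
  exact sub_eq_zero.mp (Matrix.ext hzero)

/-- `KᵀP K = Σᵢ Kᵢ (P K)ᵢ`. [folklore, bookkeeping] -/
theorem quad_eq_sum_mul_mulVec (P : Matrix n n ℝ) (K : n → ℝ) :
    ∑ i, ∑ j, K i * K j * P i j = ∑ i, K i * (P *ᵥ K) i := by
  simp only [Matrix.mulVec, dotProduct, Finset.mul_sum]
  exact Finset.sum_congr rfl fun i _ => Finset.sum_congr rfl fun j _ => by ring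

variable [DecidableEq n]

/-- **`P := (3m)⁻¹(m·1 − A)` is idempotent** when `A² + mA = 2m²·1`, `m ≠ 0`. [folklore] -/
theorem proj_mul_proj {A : Matrix n n ℝ} {m : ℝ} (hm : m ≠ 0)
    (h : A * A + m • A = (2 * m ^ 2) • (1 : Matrix n n ℝ)) :
    ((3 * m)⁻¹ • (m • (1 : Matrix n n ℝ) - A)) * ((3 * m)⁻¹ • (m • 1 - A)) =
      (3 * m)⁻¹ • (m • 1 - A) := by
  have hAA : A * A = (2 * m ^ 2) • (1 : Matrix n n ℝ) - m • A := eq_sub_of_add_eq h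
  have hsq : (m • (1 : Matrix n n ℝ) - A) * (m • 1 - A) = (3 * m) • (m • 1 - A) := by
    rw [sub_mul, Matrix.smul_mul, Matrix.one_mul, mul_sub, Matrix.mul_smul, Matrix.mul_one,
      smul_sub, hAA]
    module
  rw [Matrix.smul_mul, Matrix.mul_smul, smul_smul, hsq, smul_smul, mul_assoc,
    inv_mul_cancel₀ (mul_ne_zero three_ne_zero hm), mul_one]

end Algebra

/-! ## 3. The axis projector of a field: laws for every smooth field -/

/-- **The AXIS PROJECTOR `P(x) := (3m)⁻¹ (m·1 − S(v)(x))`** at biaxial level `m`. [ours] -/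
def axisProj (m : ℝ) (v : UnitAddTorus d → EuclideanSpace ℝ d) (x : UnitAddTorus d) :
    Matrix d d ℝ :=
  (3 * m)⁻¹ • (m • (1 : Matrix d d ℝ) - torusStrainMatrix v x)

/-- Entries of the axis projector. [ours, bookkeeping] -/
theorem axisProj_apply (m : ℝ) (v : UnitAddTorus d → EuclideanSpace ℝ d) (x : UnitAddTorus d)
    (i j : d) : axisProj m v x i j =
      (3 * m)⁻¹ * (m * (if i = j then 1 else 0) - torusStrainMatrix v x i j) := by
  simp only [axisProj, Matrix.smul_apply, Matrix.sub_apply, Matrix.one_apply, smul_eq_mul,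
    mul_ite, mul_one, mul_zero]

/-- The axis projector is symmetric. [ours, bookkeeping] -/
theorem axisProj_transpose (m : ℝ) (v : UnitAddTorus d → EuclideanSpace ℝ d)
    (x : UnitAddTorus d) : (axisProj m v x)ᵀ = axisProj m v x := by
  rw [axisProj, transpose_smul, transpose_sub, transpose_smul, transpose_one,
    (torusStrainMatrix_isSymm v x).eq]

/-- **`S = m(1 − 3P)`**, i.e. `S(v)(x) = m·1 − 3m·P(x)` (`m ≠ 0`). [ours, bookkeeping] -/
theorem strain_eq {m : ℝ} (hm : m ≠ 0) (v : UnitAddTorus d → EuclideanSpace ℝ d)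
    (x : UnitAddTorus d) :
    torusStrainMatrix v x = m • (1 : Matrix d d ℝ) - (3 * m) • axisProj m v x := by
  rw [axisProj, smul_smul, mul_inv_cancel₀ (mul_ne_zero three_ne_zero hm), one_smul,
    sub_sub_cancel]

/-- The longitudinal strain through the projector: `KᵀS K = m(|K|² − 3 KᵀP K)`. [ours] -/
theorem longitudinal_eq {m : ℝ} (hm : m ≠ 0) (v : UnitAddTorus d → EuclideanSpace ℝ d)
    (x : UnitAddTorus d) (K : d → ℝ) : ∑ i, ∑ j, K i * K j * torusStrainMatrix v x i j =
      m * (∑ i, K i ^ 2 - 3 * ∑ i, ∑ j, K i * K j * axisProj m v x i j) := by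
  have hδ : ∀ i, ∑ j, K i * K j * (if i = j then (1 : ℝ) else 0) = K i ^ 2 := fun i => by
    simp only [mul_boole, Finset.sum_ite_eq, Finset.mem_univ, if_true, sq]
  calc ∑ i, ∑ j, K i * K j * torusStrainMatrix v x i j
      = ∑ i, ∑ j, (m * (K i * K j * (if i = j then (1 : ℝ) else 0))
          - 3 * m * (K i * K j * axisProj m v x i j)) :=
        Finset.sum_congr rfl fun i _ => Finset.sum_congr rfl fun j _ => by
          rw [axisProj_apply]
          field_simp
          ring
    _ = m * (∑ i, K i ^ 2 - 3 * ∑ i, ∑ j, K i * K j * axisProj m v x i j) := by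
        simp only [Finset.sum_sub_distrib, ← Finset.mul_sum, hδ]
        ring

/-- The entries of the axis projector are smooth functions on the torus. [ours, bookkeeping] -/
theorem isSmooth_axisProj_apply (m : ℝ) {v : UnitAddTorus d → EuclideanSpace ℝ d}
    (hv : Torus.IsSmooth v) (i j : d) : Torus.IsSmooth fun x => axisProj m v x i j := by
  have h : (fun x => axisProj m v x i j) = (3 * m)⁻¹ •
      ((fun _ : UnitAddTorus d => m * (if i = j then (1 : ℝ) else 0)) -
        fun x => torusStrainMatrix v x i j) := by
    funext x
    rw [axisProj_apply, Pi.smul_apply, Pi.sub_apply, smul_eq_mul]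
  rw [h]
  exact ((isSmooth_const _).sub (isSmooth_torusStrainMatrix_entry hv i j)).smul _

/-- `∫ S(v)ᵢⱼ = 0` over the torus, for every smooth field (`∫ ∂ⱼvᵢ = 0`). [folklore] -/
theorem integral_strain_apply {v : UnitAddTorus d → EuclideanSpace ℝ d} (hv : Torus.IsSmooth v)
    (i j : d) : ∫ x, torusStrainMatrix v x i j = 0 := by
  have hint : ∀ a b : d, ∫ x, Torus.partialDeriv a v x b = 0 := fun a b => by
    simp_rw [← Torus.partialDeriv_apply_coord (hv.isContDiff (by simp)) a _ b]
    exact integral_partialDeriv_eq_zero_holds (hv.apply b) a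
  have hia : ∀ a b : d, Integrable (fun x => Torus.partialDeriv a v x b) volume := fun a b =>
    ((hv.partialDeriv a).apply b).integrable
  simp only [torusStrainMatrix, Matrix.of_apply]
  rw [integral_div, integral_add (hia j i) (hia i j), hint, hint, add_zero, zero_div]

/-- **(R28a) ISOTROPIC MEAN LAW: `∫_{T^d} P = ⅓·1`** entrywise (every smooth field). [ours] -/
theorem integral_axisProj_apply {m : ℝ} (hm : m ≠ 0) {v : UnitAddTorus d → EuclideanSpace ℝ d}
    (hv : Torus.IsSmooth v) (i j : d) :
    ∫ x, axisProj m v x i j = if i = j then 1 / 3 else 0 := by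
  simp_rw [axisProj_apply]
  rw [integral_const_mul, integral_sub (integrable_const _)
    (isSmooth_torusStrainMatrix_entry hv i j).integrable, integral_strain_apply hv, sub_zero,
    integral_const, smul_eq_mul, probReal_univ, one_mul]
  split_ifs
  · rw [mul_one, mul_inv, mul_assoc, inv_mul_cancel₀ hm, mul_one, one_div]
  · rw [mul_zero, mul_zero]

/-- **(R28a′) `∫ KᵀP K = |K|²/3`** (biaxial reading: `cos² ∠(axis, K)` averages to `1/3`). [ours] -/
theorem integral_axisQuad {m : ℝ} (hm : m ≠ 0) {v : UnitAddTorus d → EuclideanSpace ℝ d}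
    (hv : Torus.IsSmooth v) (K : d → ℝ) :
    ∫ x, ∑ i, ∑ j, K i * K j * axisProj m v x i j = (∑ i, K i ^ 2) / 3 := by
  have hI : ∀ i j, Integrable (fun x => K i * K j * axisProj m v x i j) volume := fun i j =>
    (isSmooth_axisProj_apply m hv i j).integrable.const_mul _
  rw [integral_finsetSum _ fun i _ => integrable_finsetSum _ fun j _ => hI i j]
  simp_rw [integral_finsetSum _ fun j _ => hI _ j, integral_const_mul,
    integral_axisProj_apply hm hv, mul_ite, mul_zero, Finset.sum_ite_eq, Finset.mem_univ,
    if_true, Finset.sum_div, sq]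
  exact Finset.sum_congr rfl fun i _ => by ring

/-- **(R28b) LINE LAW through the projector (every smooth field, `m ≠ 0`, every line
`t ↦ x + tK`, `K ≠ 0`, every `ε > 0`): `∃ t, (1/3 − ε)|K|² < Kᵀ P(x + tK) K` and
`∃ t, Kᵀ P(x + tK) K < (1/3 + ε)|K|²`** — for a biaxial field the LINE MAGIC-ANGLE LAW. [ours] -/
theorem exists_axisQuad_gt_and_lt {m : ℝ} (hm : m ≠ 0) {v : UnitAddTorus d → EuclideanSpace ℝ d}
    (hv : Torus.IsSmooth v) (x : UnitAddTorus d) {K : EuclideanSpace ℝ d} (hK : K ≠ 0) {ε : ℝ}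
    (hε : 0 < ε) :
    (∃ t : ℝ, (1 / 3 - ε) * ∑ i, K i ^ 2 <
      ∑ i, ∑ j, K i * K j * axisProj m v (x + Torus.proj (t • K)) i j) ∧
    ∃ t : ℝ, ∑ i, ∑ j, K i * K j * axisProj m v (x + Torus.proj (t • K)) i j <
      (1 / 3 + ε) * ∑ i, K i ^ 2 := by
  have hK2 := sum_sq_pos hK
  have hc : 0 < 3 * |m| * ε * ∑ i, K i ^ 2 := by positivity
  obtain ⟨⟨t₁, h₁⟩, ⟨t₂, h₂⟩⟩ := exists_longitudinalStrain_lt_and_gt hv x K hc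
  rw [longitudinal_eq hm] at h₁ h₂
  rcases lt_or_gt_of_ne hm with hneg | hpos
  · rw [abs_of_neg hneg] at h₁ h₂
    exact ⟨⟨t₂, by nlinarith⟩, ⟨t₁, by nlinarith⟩⟩
  · rw [abs_of_pos hpos] at h₁ h₂
    exact ⟨⟨t₁, by nlinarith⟩, ⟨t₂, by nlinarith⟩⟩

/-- **(R28c) NO KERNEL RULING (every smooth field, `m ≠ 0`): no straight line along which `K ≠ 0`
stays in `ker P`, i.e. `S(x + tK) K = m K` for all `t`** — for a biaxial field: NO RULING
ORTHOGONAL TO THE AXIS, THEOREM R step (v) in the kernel. [ours] -/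
theorem no_kernel_ruling {m : ℝ} (hm : m ≠ 0) {v : UnitAddTorus d → EuclideanSpace ℝ d}
    (hv : Torus.IsSmooth v) (x : UnitAddTorus d) {K : EuclideanSpace ℝ d} (hK : K ≠ 0) :
    ¬ ∀ t : ℝ, axisProj m v (x + Torus.proj (t • K)) *ᵥ K = 0 := by
  intro h
  obtain ⟨⟨t, ht⟩, -⟩ := exists_axisQuad_gt_and_lt hm hv x hK (by norm_num : (0 : ℝ) < 1 / 6)
  rw [quad_eq_sum_mul_mulVec, h t] at ht
  simp only [Pi.zero_apply, mul_zero, Finset.sum_const_zero] at ht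
  linarith [sum_sq_pos hK]

/-! ## 4. Everywhere-biaxial divergence-free fields on `T³`: the axis -/

section Biaxial

variable {v : UnitAddTorus (Fin 3) → EuclideanSpace ℝ (Fin 3)} (hv : Torus.IsSmooth v)
  (hdv : Torus.IsDivFree v) {m : ℝ} (hm : m ≠ 0)
include hv hdv hm

/-- **`tr P = 1` at every point** of a divergence-free field on `T³` (`tr S = 0`). [ours] -/
theorem trace_axisProj (x : UnitAddTorus (Fin 3)) : Matrix.trace (axisProj m v x) = 1 := by
  rw [axisProj, Matrix.trace_smul, Matrix.trace_sub, Matrix.trace_smul, Matrix.trace_one,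
    torusStrainMatrix_trace_eq_zero hv hdv, sub_zero, Fintype.card_fin, smul_eq_mul, smul_eq_mul,
    Nat.cast_ofNat, mul_comm m 3, inv_mul_cancel₀ (mul_ne_zero three_ne_zero hm)]

variable (hbi : ∀ x, torusStrainTopEig v x = m ∧ torusStrainMidEig v x = m)
include hbi

/-- **`P² = P` at every point** of an everywhere-biaxial field ((BI) of K79). [ours] -/
theorem axisProj_mul_self (x : UnitAddTorus (Fin 3)) :
    axisProj m v x * axisProj m v x = axisProj m v x :=
  proj_mul_proj hm (TopEig.CrossInt.strain_sq_add_smul_eq hv hdv (hbi x).1 (hbi x).2)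

/-- **THE AXIS: at every point `P = u ⊗ u` for a unit bottom eigenvector, `S u = −2m u`** — the
field is an exact periodic biaxial symmetric gradient `m(1 − 3 u ⊗ u)` with a smooth line-field
director: the hypothesis of THEOREM R (SIEVELD §3.4b (4e)). [ours] -/
theorem exists_axis (x : UnitAddTorus (Fin 3)) : ∃ u : Fin 3 → ℝ, ∑ i, u i ^ 2 = 1 ∧
    axisProj m v x = vecMulVec u u ∧ torusStrainMatrix v x *ᵥ u = (-2 * m) • u := by
  have hP := axisProj_mul_self hv hdv hm hbi x
  have htr := trace_axisProj hv hdv hm x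
  obtain ⟨u, hu1, hu⟩ := exists_unit_fixed hP (by rw [htr]; exact one_ne_zero)
  refine ⟨u, hu1, eq_vecMulVec_of_proj hP (axisProj_transpose m v x) htr hu1 hu, ?_⟩
  rw [strain_eq hm, Matrix.sub_mulVec, Matrix.smul_mulVec, Matrix.one_mulVec, Matrix.smul_mulVec,
    hu, ← sub_smul, show m - 3 * m = -2 * m by ring]

end Biaxial

/-! ## 5. Oriented axis: the hand-off to THEOREM R (i)–(ii) of the tree (`BiaxialTwistFree`) -/

section Oriented

variable {v n : UnitAddTorus (Fin 3) → EuclideanSpace ℝ (Fin 3)} (hv : Torus.IsSmooth v)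
  (hdv : Torus.IsDivFree v) (hn : Torus.IsSmooth n) {m : ℝ} (hm : m ≠ 0)
  (hP : ∀ x, axisProj m v x = vecMulVec (n x) (n x))
include hm hP

/-- An oriented axis field `n` (`P = n ⊗ n`) gives the DIRECTOR FORM `S = m(1 − 3 n ⊗ n)`.
[ours, bookkeeping] -/
theorem strain_eq_director (x : UnitAddTorus (Fin 3)) :
    torusStrainMatrix v x = m • (1 - (3 : ℝ) • vecMulVec (n x) (n x)) := by
  rw [strain_eq hm, hP x, smul_sub, smul_smul, mul_comm m 3]

include hv hdv

/-- An oriented axis field is a UNIT field: `Σᵢ nᵢ² = tr P = 1`. [ours] -/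
theorem sum_sq_eq_one (x : UnitAddTorus (Fin 3)) : ∑ i, n x i ^ 2 = 1 := by
  have h := trace_axisProj hv hdv hm x
  rw [hP x, trace_vecMulVec, dotProduct] at h
  simpa only [sq] using h

include hn

/-- **(R28d) THEOREM R (i) for an oriented axis, by name: the axis is TWIST-FREE,
`n·curl n ≡ 0`** (`BiaxialEikonal.twist_eq_zero_fin3`). [ours = assembly] -/
theorem twist_eq_zero (x : UnitAddTorus (Fin 3)) :
    n x 0 * (Torus.partialDeriv 1 n x 2 - Torus.partialDeriv 2 n x 1)
      + n x 1 * (Torus.partialDeriv 2 n x 0 - Torus.partialDeriv 0 n x 2)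
      + n x 2 * (Torus.partialDeriv 0 n x 1 - Torus.partialDeriv 1 n x 0) = 0 :=
  BiaxialEikonal.twist_eq_zero_fin3 hv hn (sum_sq_eq_one hv hdv hm hP) hm
    (strain_eq_director hm hP) x

/-- **(R28d) THEOREM R (ii) for an oriented axis, by name: SADDLE-SPLAY-FREE,
`(div n)² ≡ tr((∇n)²)`** (every leaf of the integrable plane field `n^⊥` is flat;
`BiaxialEikonal.div_sq_eq_trace_sq`). [ours = assembly] -/
theorem div_sq_eq_trace_sq (x : UnitAddTorus (Fin 3)) :
    (∑ k, Torus.partialDeriv k n x k) ^ 2 =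
      ∑ l, ∑ k, Torus.partialDeriv k n x l * Torus.partialDeriv l n x k :=
  BiaxialEikonal.div_sq_eq_trace_sq hv hn (sum_sq_eq_one hv hdv hm hP) hm
    (strain_eq_director hm hP) x

end Oriented

end TopEig.BiAxis

end Summit.NavierStokesRegularity.FunctionalMining

end
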